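import Literature.MathematicalPhysics.QuantumFieldTheory.Federbush1986.BallCutoffs

/-!
# `Federbush1986.BallSmoothing` — [Federbush1988PhaseCellIV] Appendix A, part C, proof of Theorem A.3, (A.30) p. 342: the
# boundary-scale mollification `f^{s′}` of a Lipschitz map on the unit ball — `f^{s′} = f` on `∂B`, continuous, `C^∞` inside,
# `|f^{s′}(x) − f(x)| ≤ 4εΛ₁ d(x)` — PROVED (the (A.26)-type derivative bounds follow in `BallSmoothingDeriv`)

statement-level skeleton of published theorems with citation tags; proofs where landed; nothing here is a claim about the Yang–Mills mass gap

CITATION HEADER.  P. Federbush, *A phase cell approach to Yang–Mills theory. IV. The choice of variables*, Commun. Math.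
Phys. **114** (1988) 317–343 [Federbush1988PhaseCellIV], Appendix A part C, Theorem A.3 and its proof (A.27)–(A.31) p. 342
(render f4-p026 of unit `lit-balaban-r19`, read as an image).  Cell `lit-balaban`, Phase-2 proof seat **p04 gen 7**; SKELETON
row **F4.ThmA.3** (decl of record `PhaseCellIVAppA.ThmA3ContCap`, p251889; fold owner r19).  Inputs BY NAME: `LipschitzMollifier`
(p258818: `moll`, `norm_moll_sub_le`, `contDiff_moll`) and `BallCutoffs` (`theta`, `psi`, `sum_psi_eq_one`, `exists_level`, …).

WHAT IS PRINTED (p. 342).  «Let `f^{s′}_ε(x) = ∫ w^{εd(x)}(x − y) f(y) dy` (A.30) and `f^s_ε(x) = Pr_M(f^{s′}_ε(x))` (A.31) …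
(we note `f^s(x)` is not defined for `x ∈ ∂B` by (A.30), but by (A.25).)»  THIS FILE constructs `f^{s′}` (before the projection)
for a Lipschitz `g : ℝⁿ → F` (print's `f` viewed in `R^t`, extended to `ℝⁿ`): with the dyadic partition `ψ_j` of the open
ball (`BallCutoffs`) and the fixed-scale mollifiers `w^h ⋆ g` (`LipschitzMollifier.moll`),
`smooth ε g := g + Σ_j ψ_j·(w^{ε2^{−j}} ⋆ g − g)`, i.e. on the shell `θ ≍ 2^{−j}` the mollification at scale `h = ε2^{−j} ≍
εθ(x) ≍ εd(x, ∂B)` — print's `w^{εd(x)} ⋆ f` with the scale frozen dyadically — and `= g` outside the open ball (so on `∂B`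
it is defined «by (A.25)», not by the integral).  PROVED here: `smooth ε g = g` off the open ball and on `∂B` ((A.25)),
local finite form `smooth ε g = Σ_{j≤J} ψ_j·(w^{h_j} ⋆ g)` on `{θ > 2^{−J}}`, `C^∞` on the open ball, `‖smooth ε g(x) −
g(x)‖ ≤ 4εΛ₁(g)θ(x)` (so `f^{s′}` stays in the `4εΛ₁`-neighbourhood of `M` — «for `ε` small enough»), and continuity on all of
`ℝⁿ` (hence `f^{s′} : B → R^t` is a mapping continuous up to the boundary).

WHAT THIS MODULE PROVIDES (namespace `BallSmoothing`): defs with bodies `hs` (the scales `h_j = ε2^{−j}`), `smooth`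
(`f^{s′}`), `partialSum`; theorems `hs_pos`, `hs_mono`, `hs_le_four_mul`, `two_pow_mul_hs`, `two_pow_eq`, `psi_eq_zero_above`,
`psi_eq_zero_below`, `psi_eventuallyEq_zero_below`, `smooth_eq_of_not_mem_ball`, `smooth_eq_on_sphere`, `smooth_sub_eq_sum`, `smooth_eq_partialSum`,
`smooth_eventuallyEq_partialSum`, `contDiff_partialSum`, `contDiffAt_smooth`, `contDiffOn_smooth`, **`norm_smooth_sub_le`**,
`norm_smooth_sub_le'`, `dist_smooth_le_of_mem_sphere`, **`continuous_smooth`**.  No `Prop`-valued definition, no named fact;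
axioms standard.
-/

namespace Literature.MathematicalPhysics.QuantumFieldTheory.Federbush1986

noncomputable section

open MeasureTheory Metric Set Filter Function
open scoped ContDiff Topology NNReal

namespace BallSmoothing

open LipschitzMollifier BallCutoffs

variable {n : ℕ} {F : Type*} [NormedAddCommGroup F] [NormedSpace ℝ F]

/-! ## §1 The dyadic scales `h_j = ε·2^{−j}` -/

/-- The mollification scale on the `j`-th shell: `h_j = ε2^{−j}` (≍ `εd(x)` there). [cite: Federbush1988PhaseCellIV, (A.30)
p. 342] -/
def hs (ε : ℝ) (j : ℕ) : ℝ := ε * (1 / 2 : ℝ) ^ j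

/-- `h_j > 0`. [cite: Federbush1988PhaseCellIV, (A.30) p. 342] -/
theorem hs_pos {ε : ℝ} (hε : 0 < ε) (j : ℕ) : 0 < hs ε j := by unfold hs; positivity

/-- `h_{j'} ≤ h_j` for `j ≤ j'`. [cite: Federbush1988PhaseCellIV, (A.30) p. 342] -/
theorem hs_mono {ε : ℝ} (hε : 0 < ε) {j j' : ℕ} (h : j ≤ j') : hs ε j' ≤ hs ε j := by
  unfold hs
  exact mul_le_mul_of_nonneg_left (pow_le_pow_of_le_one (by norm_num) (by norm_num) h) hε.le

/-- `h_j ≤ 4h_J` for `j ≥ J − 2`. [cite: Federbush1988PhaseCellIV, (A.30) p. 342] -/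
theorem hs_le_four_mul {ε : ℝ} (hε : 0 < ε) {J j : ℕ} (h : J ≤ j + 2) : hs ε j ≤ 4 * hs ε J := by
  have h2 : hs ε J ≥ hs ε (j + 2) := hs_mono hε h
  have h3 : hs ε (j + 2) = hs ε j / 4 := by unfold hs; rw [pow_add]; ring
  rw [h3] at h2
  linarith

/-- `2^J·h_J = ε`. [cite: Federbush1988PhaseCellIV, (A.30) p. 342] -/
theorem two_pow_mul_hs (ε : ℝ) (J : ℕ) : (2 : ℝ) ^ J * hs ε J = ε := by
  unfold hs
  rw [mul_left_comm, ← mul_pow]; norm_num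

/-- `2^J = ε·h_J⁻¹`. [cite: Federbush1988PhaseCellIV, (A.30) p. 342] -/
theorem two_pow_eq {ε : ℝ} (hε : 0 < ε) (J : ℕ) : (2 : ℝ) ^ J = ε * (hs ε J)⁻¹ := by
  have h := two_pow_mul_hs ε J
  have hpos := hs_pos hε J
  field_simp
  linarith

/-! ## §2 Which cutoffs are alive at a point of level `J` (`2^{−J} < θ(x) ≤ 2·2^{−J}`) -/

/-- Above the level: `ψ_j(x) = 0` for `j ≥ J + 1` when `θ(x) > 2^{−J}`. [cite: Federbush1988PhaseCellIV, (A.30) p. 342] -/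
theorem psi_eq_zero_above {J j : ℕ} {x : Euc n} (hJ : (1 / 2 : ℝ) ^ J < theta x) (hj : J + 1 ≤ j) : psi j x = 0 := by
  apply psi_eq_zero_of_ge
  have hθ : 0 < theta x := lt_of_le_of_lt (by positivity) hJ
  have h1 : (2 : ℝ) ^ (J + 1) ≤ 2 ^ j := pow_le_pow_right₀ (by norm_num) hj
  have h2 : (2 : ℝ) ^ (J + 1) * (1 / 2 : ℝ) ^ J = 2 := by rw [pow_succ, mul_assoc, mul_comm 2, ← mul_assoc, ← mul_pow]; norm_num
  calc (2 : ℝ) = 2 ^ (J + 1) * (1 / 2 : ℝ) ^ J := h2.symm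
    _ ≤ 2 ^ (J + 1) * theta x := mul_le_mul_of_nonneg_left hJ.le (by positivity)
    _ ≤ 2 ^ j * theta x := mul_le_mul_of_nonneg_right h1 hθ.le

/-- Below the level: `ψ_j(x) = 0` for `j + 2 ≤ J` when `θ(x) ≤ 2·2^{−J}`. [cite: Federbush1988PhaseCellIV, (A.30) p. 342] -/
theorem psi_eq_zero_below {J j : ℕ} {x : Euc n} (hJ : theta x ≤ 2 * (1 / 2 : ℝ) ^ J) (hj : j + 2 ≤ J) : psi j x = 0 := by
  apply psi_eq_zero_of_le
  have h1 : (1 / 2 : ℝ) ^ J ≤ (1 / 2) ^ (j + 2) := pow_le_pow_of_le_one (by norm_num) (by norm_num) hj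
  have h2 : (2 : ℝ) ^ (j + 1) * (2 * (1 / 2 : ℝ) ^ (j + 2)) = 1 := by
    rw [show (2 : ℝ) * (1 / 2) ^ (j + 2) = (1 / 2) ^ (j + 1) by rw [pow_succ (1 / 2 : ℝ) (j + 1)]; ring, ← mul_pow]; norm_num
  calc (2 : ℝ) ^ (j + 1) * theta x ≤ 2 ^ (j + 1) * (2 * (1 / 2 : ℝ) ^ J) := by gcongr
    _ ≤ 2 ^ (j + 1) * (2 * (1 / 2 : ℝ) ^ (j + 2)) := by gcongr
    _ = 1 := h2

/-- Strictly below the level: `ψ_j ≡ 0` NEAR `x` for `j + 3 ≤ J` when `θ(x) ≤ 2·2^{−J}`. [cite: Federbush1988PhaseCellIV,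
(A.30) p. 342] -/
theorem psi_eventuallyEq_zero_below {J j : ℕ} {x : Euc n} (hJ : theta x ≤ 2 * (1 / 2 : ℝ) ^ J) (hj : j + 3 ≤ J) :
    (psi j : Euc n → ℝ) =ᶠ[𝓝 x] fun _ => 0 := by
  apply psi_eventuallyEq_zero_of_lt
  have h1 : (1 / 2 : ℝ) ^ J ≤ (1 / 2) ^ (j + 3) := pow_le_pow_of_le_one (by norm_num) (by norm_num) hj
  have h2 : (2 : ℝ) ^ (j + 1) * (2 * (1 / 2 : ℝ) ^ (j + 3)) = 1 / 2 := by
    rw [show (2 : ℝ) * (1 / 2) ^ (j + 3) = (1 / 2) ^ (j + 1) * (1 / 2) by rw [pow_succ, pow_succ]; ring, ← mul_assoc,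
      ← mul_pow]; norm_num
  calc (2 : ℝ) ^ (j + 1) * theta x ≤ 2 ^ (j + 1) * (2 * (1 / 2 : ℝ) ^ J) := by gcongr
    _ ≤ 2 ^ (j + 1) * (2 * (1 / 2 : ℝ) ^ (j + 3)) := by gcongr
    _ = 1 / 2 := h2
    _ < 1 := by norm_num

/-! ## §3 The smoothing operator `f^{s′}` -/

/-- **`f^{s′}`**: `smooth ε g := g + Σ_j ψ_j·(w^{h_j} ⋆ g − g)` — on the shell `θ ≍ 2^{−j}` the mollification of `g` at scale
`h_j = ε2^{−j} ≍ εd(x)` ((A.30) with the scale frozen dyadically), and `= g` off the open ball ((A.25): «`f^s|_{∂B} =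
f|_{∂B}`»). [cite: Federbush1988PhaseCellIV, (A.25), (A.30) p. 342] -/
def smooth (ε : ℝ) (g : Euc n → F) (x : Euc n) : F := g x + ∑' j, psi j x • (moll g (hs ε j) x - g x)

/-- The local finite form `Σ_{j≤J} ψ_j·(w^{h_j} ⋆ g)`. [cite: Federbush1988PhaseCellIV, (A.30) p. 342] -/
def partialSum (ε : ℝ) (g : Euc n → F) (J : ℕ) (x : Euc n) : F :=
  ∑ j ∈ Finset.range (J + 1), psi j x • moll g (hs ε j) x

/-- (A.25): off the open ball `f^{s′} = f`. [cite: Federbush1988PhaseCellIV, (A.25) p. 342] -/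
theorem smooth_eq_of_not_mem_ball {ε : ℝ} {g : Euc n → F} {x : Euc n} (hx : x ∉ ball (0 : Euc n) 1) :
    smooth ε g x = g x := by
  unfold smooth
  simp [psi_eq_zero_of_not_mem_ball hx]

/-- **(A.25)** `f^{s′}|_{∂B} = f|_{∂B}`. [cite: Federbush1988PhaseCellIV, (A.25) p. 342] -/
theorem smooth_eq_on_sphere {ε : ℝ} {g : Euc n → F} {x : Euc n} (hx : x ∈ sphere (0 : Euc n) 1) : smooth ε g x = g x :=
  smooth_eq_of_not_mem_ball (by rw [mem_sphere] at hx; rw [mem_ball]; linarith)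

/-- Finite form of the correction above level `J`: if `θ(x) > 2^{−J}` then `f^{s′}(x) − g(x) = Σ_{j≤J} ψ_j(x)(w^{h_j} ⋆ g − g)(x)`.
[cite: Federbush1988PhaseCellIV, (A.30) p. 342] -/
theorem smooth_sub_eq_sum {ε : ℝ} {g : Euc n → F} {J : ℕ} {x : Euc n} (hJ : (1 / 2 : ℝ) ^ J < theta x) :
    smooth ε g x - g x = ∑ j ∈ Finset.range (J + 1), psi j x • (moll g (hs ε j) x - g x) := by
  unfold smooth
  rw [add_sub_cancel_left]
  refine tsum_eq_sum fun j hj => ?_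
  rw [Finset.mem_range, not_lt] at hj
  rw [psi_eq_zero_above hJ hj, zero_smul]

/-- Local finite form: if `θ(x) > 2^{−J}` then `f^{s′}(x) = Σ_{j≤J} ψ_j(x)·(w^{h_j} ⋆ g)(x)` (partition of unity).
[cite: Federbush1988PhaseCellIV, (A.30) p. 342] -/
theorem smooth_eq_partialSum {ε : ℝ} {g : Euc n → F} {J : ℕ} {x : Euc n} (hJ : (1 / 2 : ℝ) ^ J < theta x) :
    smooth ε g x = partialSum ε g J x := by
  have h1 := smooth_sub_eq_sum (ε := ε) (g := g) hJ
  have hone : ∑ j ∈ Finset.range (J + 1), psi j x = 1 := by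
    apply sum_psi_eq_one
    have hθ : 0 < theta x := lt_of_le_of_lt (by positivity) hJ
    have : (2 : ℝ) ^ (J + 1) * (1 / 2 : ℝ) ^ J = 2 := by
      rw [pow_succ, mul_assoc, mul_comm 2, ← mul_assoc, ← mul_pow]; norm_num
    nlinarith [mul_le_mul_of_nonneg_left hJ.le (by positivity : (0 : ℝ) ≤ 2 ^ (J + 1))]
  simp only [smul_sub, Finset.sum_sub_distrib, ← Finset.sum_smul, hone, one_smul] at h1
  unfold partialSum
  exact sub_left_inj.mp h1

/-- The local finite form holds on a neighbourhood. [cite: Federbush1988PhaseCellIV, (A.30) p. 342] -/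
theorem smooth_eventuallyEq_partialSum {ε : ℝ} {g : Euc n → F} {J : ℕ} {x : Euc n} (hJ : (1 / 2 : ℝ) ^ J < theta x) :
    smooth ε g =ᶠ[𝓝 x] partialSum ε g J := by
  filter_upwards [continuousAt_const.eventually_lt continuous_theta.continuousAt hJ] with y hy
    using smooth_eq_partialSum hy

/-- The local finite forms are `C^∞` (finite sums of smooth functions). [cite: Federbush1988PhaseCellIV, (A.30) p. 342] -/
theorem contDiff_partialSum {ε : ℝ} {g : Euc n → F} (hg : Continuous g) (J : ℕ) : ContDiff ℝ ∞ (partialSum ε g J) := by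
  unfold partialSum
  exact ContDiff.sum fun j _ => (contDiff_psi j).smul (contDiff_moll hg _)

/-- `f^{s′}` is `C^∞` at every interior point. [cite: Federbush1988PhaseCellIV, Theorem A.3 p. 342] -/
theorem contDiffAt_smooth {ε : ℝ} {g : Euc n → F} (hg : Continuous g) {x : Euc n} (hx : x ∈ ball (0 : Euc n) 1) :
    ContDiffAt ℝ ∞ (smooth ε g) x := by
  obtain ⟨J, hJ⟩ := exists_pow_lt_of_lt_one (theta_pos hx) (by norm_num : (1 / 2 : ℝ) < 1)
  exact ((contDiff_partialSum hg J).contDiffAt).congr_of_eventuallyEq (smooth_eventuallyEq_partialSum hJ)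

/-- **`f^{s′} ∈ C^∞(B°)`**. [cite: Federbush1988PhaseCellIV, Theorem A.3 (A.26) p. 342] -/
theorem contDiffOn_smooth {ε : ℝ} {g : Euc n → F} (hg : Continuous g) : ContDiffOn ℝ ∞ (smooth ε g) (ball (0 : Euc n) 1) :=
  fun _ hx => (contDiffAt_smooth hg hx).contDiffWithinAt

/-! ## §4 `f^{s′}` stays close to `f`: `‖f^{s′}(x) − g(x)‖ ≤ 4εΛ₁(g)θ(x)` -/

/-- **`‖f^{s′}(x) − g(x)‖ ≤ 4εΛ₁(g)θ(x)`** on the open ball: only the two shells `j ∈ {J−1, J}` at the level of `x` contribute,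
each by `≤ Λ₁(g)h_j ≤ 2εΛ₁(g)2^{−J} < 2εΛ₁(g)θ(x)` («for `ε` small enough» `f^{s′}` stays in the tubular neighbourhood of `M`).
[cite: Federbush1988PhaseCellIV, (A.30)–(A.31) p. 342] -/
theorem norm_smooth_sub_le [CompleteSpace F] {ε : ℝ} (hε : 0 < ε) {g : Euc n → F} {K : ℝ≥0} (hg : LipschitzWith K g)
    {x : Euc n} (hx : x ∈ ball (0 : Euc n) 1) : ‖smooth ε g x - g x‖ ≤ 4 * ε * K * theta x := by
  obtain ⟨J, hJ1, hJlt, hJle⟩ := exists_level (theta_pos hx) (theta_le_one x)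
  rw [smooth_sub_eq_sum hJlt]
  -- only `j ∈ Icc (J-1) J` contribute
  have hsub : Finset.Icc (J - 1) J ⊆ Finset.range (J + 1) := by
    intro j hj
    rw [Finset.mem_Icc] at hj
    rw [Finset.mem_range]
    omega
  rw [← Finset.sum_subset hsub (fun j hj hj' => by
    rw [Finset.mem_range] at hj
    rw [Finset.mem_Icc, not_and_or, not_le, not_le] at hj'
    have hj2 : j + 2 ≤ J := by omega
    rw [psi_eq_zero_below hJle hj2, zero_smul])]
  have hterm : ∀ j ∈ Finset.Icc (J - 1) J, ‖psi j x • (moll g (hs ε j) x - g x)‖ ≤ 2 * ε * K * theta x := by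
    intro j hj
    rw [Finset.mem_Icc] at hj
    rw [norm_smul, Real.norm_eq_abs]
    have h1 : ‖moll g (hs ε j) x - g x‖ ≤ K * hs ε j := norm_moll_sub_le hg (hs_pos hε j) x
    have h2 : hs ε j ≤ 2 * hs ε J := by
      have := hs_mono hε (show J - 1 ≤ j from hj.1)
      have h3 : hs ε (J - 1) = 2 * hs ε J := by
        obtain ⟨K', hK'⟩ := Nat.exists_eq_succ_of_ne_zero (Nat.one_le_iff_ne_zero.mp hJ1)
        subst hK'
        simp only [Nat.succ_sub_one, hs, pow_succ]
        ring
      linarith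
    have h4 : hs ε J < ε * theta x := by unfold hs; exact mul_lt_mul_of_pos_left hJlt hε
    calc |psi j x| * ‖moll g (hs ε j) x - g x‖ ≤ 1 * (K * hs ε j) :=
          mul_le_mul (abs_psi_le_one j x) h1 (norm_nonneg _) zero_le_one
      _ ≤ 2 * ε * K * theta x := by nlinarith [K.coe_nonneg, hs_pos hε J]
  calc ‖∑ j ∈ Finset.Icc (J - 1) J, psi j x • (moll g (hs ε j) x - g x)‖
      ≤ ∑ j ∈ Finset.Icc (J - 1) J, ‖psi j x • (moll g (hs ε j) x - g x)‖ := norm_sum_le _ _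
    _ ≤ (Finset.Icc (J - 1) J).card • (2 * ε * K * theta x) := Finset.sum_le_card_nsmul _ _ _ hterm
    _ ≤ 2 • (2 * ε * K * theta x) := by
        have hc : (Finset.Icc (J - 1) J).card ≤ 2 := by rw [Nat.card_Icc]; omega
        have h0 : 0 ≤ 2 * ε * K * theta x := by
          have := (theta_pos hx).le; positivity
        exact nsmul_le_nsmul_left h0 hc
    _ = 4 * ε * K * theta x := by rw [nsmul_eq_mul]; ring

/-- Global form: `‖f^{s′}(x) − g(x)‖ ≤ 4εΛ₁(g)·max(θ(x), 0)` for every `x`. [cite: Federbush1988PhaseCellIV, (A.30) p. 342] -/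
theorem norm_smooth_sub_le' [CompleteSpace F] {ε : ℝ} (hε : 0 < ε) {g : Euc n → F} {K : ℝ≥0} (hg : LipschitzWith K g)
    (x : Euc n) : ‖smooth ε g x - g x‖ ≤ 4 * ε * K * max (theta x) 0 := by
  by_cases hx : x ∈ ball (0 : Euc n) 1
  · exact (norm_smooth_sub_le hε hg hx).trans (by gcongr; exact le_max_left _ _)
  · rw [smooth_eq_of_not_mem_ball hx, sub_self, norm_zero]; positivity

/-! ## §5 Continuity of `f^{s′}` on all of `ℝⁿ` (in particular on the closed ball, «a mapping `f^s : B → M`») -/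

/-- At a boundary point `x₁ ∈ ∂B`: `‖f^{s′}(y) − f^{s′}(x₁)‖ ≤ (8ε + 1)Λ₁(g)‖y − x₁‖` for every `y` (as `θ(y) ≤ 2‖y − x₁‖`).
[cite: Federbush1988PhaseCellIV, (A.25)/(A.30) p. 342] -/
theorem dist_smooth_le_of_mem_sphere [CompleteSpace F] {ε : ℝ} (hε : 0 < ε) {g : Euc n → F} {K : ℝ≥0}
    (hg : LipschitzWith K g) {x₁ : Euc n} (hx₁ : x₁ ∈ sphere (0 : Euc n) 1) (y : Euc n) :
    dist (smooth ε g y) (smooth ε g x₁) ≤ (8 * ε + 1) * K * dist y x₁ := by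
  rw [smooth_eq_on_sphere hx₁]
  have hθ : max (theta y) 0 ≤ 2 * dist y x₁ := by
    refine max_le ?_ (by positivity)
    rw [mem_sphere, dist_zero_right] at hx₁
    have h1 := theta_le_two_mul y
    have h2 : 1 - ‖y‖ ≤ dist y x₁ := by
      rw [dist_eq_norm, ← hx₁]
      have := norm_sub_norm_le x₁ y
      rw [norm_sub_rev] at this
      linarith
    linarith
  calc dist (smooth ε g y) (g x₁) ≤ dist (smooth ε g y) (g y) + dist (g y) (g x₁) := dist_triangle _ _ _
    _ ≤ 4 * ε * K * max (theta y) 0 + K * dist y x₁ := by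
        rw [dist_eq_norm]; exact add_le_add (norm_smooth_sub_le' hε hg y) (hg.dist_le_mul y x₁)
    _ ≤ 4 * ε * K * (2 * dist y x₁) + K * dist y x₁ := by gcongr
    _ = (8 * ε + 1) * K * dist y x₁ := by ring

/-- **`f^{s′}` is continuous on `ℝⁿ`** (smooth inside the ball, `= g` outside, Lipschitz-pinched at the sphere) — in
particular a continuous mapping on the closed ball. [cite: Federbush1988PhaseCellIV, Theorem A.3 (A.25) p. 342] -/
theorem continuous_smooth [CompleteSpace F] {ε : ℝ} (hε : 0 < ε) {g : Euc n → F} {K : ℝ≥0} (hg : LipschitzWith K g) :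
    Continuous (smooth ε g) := by
  rw [continuous_iff_continuousAt]
  intro x
  rcases lt_trichotomy ‖x‖ 1 with hlt | heq | hgt
  · exact (contDiffAt_smooth (ε := ε) hg.continuous (by rwa [mem_ball, dist_zero_right])).continuousAt
  · have hx : x ∈ sphere (0 : Euc n) 1 := by rwa [mem_sphere, dist_zero_right]
    rw [Metric.continuousAt_iff]
    intro δ hδ
    refine ⟨δ / ((8 * ε + 1) * K + 1), by positivity, fun y hy => ?_⟩
    calc dist (smooth ε g y) (smooth ε g x) ≤ (8 * ε + 1) * K * dist y x := dist_smooth_le_of_mem_sphere hε hg hx y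
      _ ≤ ((8 * ε + 1) * K + 1) * dist y x := by gcongr; linarith
      _ < ((8 * ε + 1) * K + 1) * (δ / ((8 * ε + 1) * K + 1)) := by gcongr
      _ = δ := by field_simp
  · have hev : smooth ε g =ᶠ[𝓝 x] g := by
      have hopen : IsOpen {y : Euc n | 1 < ‖y‖} := isOpen_lt continuous_const continuous_norm
      filter_upwards [hopen.mem_nhds hgt] with y hy
      exact smooth_eq_of_not_mem_ball (by rw [mem_ball, dist_zero_right, not_lt]; exact le_of_lt hy)
    exact (hg.continuous.continuousAt).congr_of_eventuallyEq hev

end BallSmoothing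

end

end Literature.MathematicalPhysics.QuantumFieldTheory.Federbush1986
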